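import Summits.QuantumFields.YangMills.Theorems.BalabanUVNodesN21ChartExponentCoercivityBox
import Summits.QuantumFields.YangMills.Theorems.BalabanUVNodesN21ChartExponentCoercivitySUN

/-!
# N21 (NE7c) · THE (1.9) BINDER OF THE (M1) ENDs ON pub-balaban's `BlockChartSU N b` FROM THE (1.7) ROW + PROVED (1.8)
# FOR A RECTANGULAR PARALLELEPIPED, through a bond dictionary `↥b ≃` off-tree bonds of a BOX — and the dictionary EXISTS
# for every non-wrapping box of the lane's torus (file 9 of WIDTH-209 N21 piece 2; box edition of file 7)

Width seat pub-ymgap-dag-n21-w3 (g5), node N21 = NE7c (NOT PRINTED, NOT proved), lane K3⁸ `SpineGivenEndpointR13SepCoPHV`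
(stmt-QuantumFields-27366, `--kind proof --supports … --as helper`; K3⁷ 20544 = aside ∕ lineage).  Companion of file 8
`…N21ChartExponentCoercivityBox` (the flat-frame reading of `h19` from (1.7) + `B16Eq18Proof.ineq18_box_vec` +
`B16Sect1Wilson.ineq19_of_17_18` on a box `Λ = box n y` with arbitrary sides `n_i ≤ 100M`); box edition of file 7
`…N21ChartExponentCoercivitySUN` (p618320), whose dictionary reached only CUBES `block n y`.

WHY.  The ENDs that matter for dag-n21-w2's junctions live on `BlockChartSU N b = ↥b → E_N` and display
`h19 : ∀ v, Ineq19 (Qf v) (Σ_{b′} ‖v b′‖²) γ₀ d M`.  Reading it from print's (1.7) needs (1.8), and print's (1.8) is about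
*"Λ … a rectangular parallelepiped contained in a cube of the size 100M"* ([LF-II] p. 358; [IV] (1.73) p. 192) in an axial
(comb) gauge — the Literature's `B16Eq18Proof.ineq18_box_vec`.  This file makes the identification of the block's torus
bonds with the OFF-TREE INNER BONDS OF A BOX an explicit datum `e : ↥b ≃ ↥(innerBonds n y ∖ treeBonds n y)` (carriers of
`B16Eq18Proof`, sides `n : Fin d → ℕ`) and proves (§3) that the datum is INHABITED for every box with sides `n_i ≤` the
torus period, with `b` = the box's off-tree inner bonds read on `T^{(j)}` by reducing coordinates `mod 2L^{m+K−j}` and `e`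
= that reduction.  File 7's `1 ≤ n` binder is gone, as in file 8.

WHAT (THEOREMS ONLY; 0 `def`, 0 `sorry`).
* §1 ★ `ineq19_blockChartSU_of_ineq17_box`: given `e`, the (1.7) row for the quadratic member `Qf : BlockChartSU N b → ℝ`
  (curl-form of the 𝔤-valued bond configuration `bd ↦ v (e⁻¹ bd)` extended by zero, against `Σ_{b′} ‖v b′‖²`), `1 ≤ d`,
  `∀ i, n i ≤ 100M`, `1 ≤ M`, `0 ≤ γ₀` and the smallness line `C(M⁶R_kε_k + e^{−R_k}) ≤ γ₀∕(2d(100M)^{d+1})` ⇒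
  `∀ v, Ineq19 (Qf v) (Σ_{b′} ‖v b′‖²) γ₀ d M` — the `BlockChartSU` ENDs' `h19` VERBATIM, box carrier.
* §2 ★★ `convexOn_blockChartSU_expansion_of_ineq17_analyticSupBound_box` = file 5's (p613088) ★★′-loc on
  `BlockChartSU N b` with `h19` DISCHARGED by §1.
* §3 [folklore] `toPBond_injOn_box` (reduction `mod` the period is injective on the bonds starting in a box with sides
  `n_i ≤ period`) and ★ `exists_offTreeBox_equiv`: for every `y` and `n` with `∀ i, n i ≤ P.sitesPerDir j` there are
  `b : Finset (PBond P j)` and `e : ↥b ≃ ↥(innerBonds n y ∖ treeBonds n y)` with `e⁻¹` = reduction of coordinates — the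
  datum of §1 is inhabited at the lane's types (A6), non-junk (the clause pins `e`).
* §4 [knit] `exists_offTreeBlock_equiv_of_box`: file 7's ★ `exists_offTreeBlock_equiv` (cubes) RE-DERIVED from §3 at
  `n = fun _ ↦ L` (carriers agree by file 8 §0 ∕ `treeBonds_const`).

HONEST FRAMING.  [textbook]∕[folklore] over file 8, file 5 and p604008 BY NAME; (1.7) stays a DISPLAYED ROW about NODE O's
operator `Δ₁(ζ₀)`, NOT asserted; which block `b`, box `box n y`, corner and gauge tree the lane's (M1) package must use is
dag-n21-w2 ∕ dag-n21-d's measure-side decision (LOCATED-1 l.30536: tree gauge), not made here; the identification of an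
END's `Qf` with ⟨H_{1,k}B′, Δ₁(ζ₀)H_{1,k}B′⟩ is LOCATED typing; nothing of Bałaban's asserted; (M1) ∕ NE7c NOT PRINTED ∕ NOT
proved; N21 NOT discharged; K3⁸ NOT claimed; counts unmoved (typed 28∕28 · discharged 5∕27); count-neutral; one finite 𝕋⁴ at
fixed ε — the Yang–Mills mass gap (Clay) is NOT proved by any of this: R4 closes the conditional finite-𝕋⁴ rung
`BalabanLadder.UV` only; nothing continuum ∕ ℝ⁴ ∕ OS.
-/

set_option autoImplicit false

noncomputable section

open Set Function Finset Matrix Metric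

namespace Summit.QuantumFields.YangMills.Theorems.N21ChartExponentCoercivityBoxSUN

open Literature.MathematicalPhysics.QuantumFieldTheory.Balaban1983to89
open Literature.MathematicalPhysics.QuantumFieldTheory.Balaban1983to89.B16Sect1Wilson
  (Ineq17 Ineq18 Ineq19 ineq19_of_17_18)
open Literature.MathematicalPhysics.QuantumFieldTheory.Balaban1983to89.B6TreeGaugePoincare (Cfg curl)
open Literature.MathematicalPhysics.QuantumFieldTheory.Balaban1983to89.B6BondElimination (unitVec)
open Literature.MathematicalPhysics.QuantumFieldTheory.Balaban1983to89.B16Eq18Proof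
  (box mem_box treeBonds mem_treeBonds innerBonds mem_innerBonds innerPlaq treeBonds_subset_innerBonds ineq18_box_vec
    box_const treeBonds_const)
open Summit.QuantumFields.BalabanUV.T4Continuum.ShellMeasureExpChartSUN (BlockChartSU dimSU)
open Summit.QuantumFields.YangMills.Theorems.N21LowCentreEndAtSUNBlockChart (sum_sq_flatten)
open Summit.QuantumFields.YangMills.Theorems.N21ChartExponentConvexityLocalSUN
  (convexOn_blockChartSU_expansion_of_analyticSupBound_local)
open Summit.QuantumFields.YangMills.Theorems.N21ChartExponentCoercivityBox
  (innerBonds_const extendOffSubfinset_eq_zero sum_sq_extendOffSubfinset)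

variable {N : ℕ} {P : Params} {j : ℕ} {d : ℕ}

/-! ## §1  ★ The `BlockChartSU` ENDs' (1.9) binder from the (1.7) row + PROVED (1.8), through a BOX bond dictionary -/

section Coercivity

variable {n : Fin d → ℕ}

/-- ★ **(1.9) ON `BlockChartSU N b` FROM (1.7) + PROVED (1.8) FOR A RECTANGULAR PARALLELEPIPED, THROUGH A BOND DICTIONARY.**
Let `e : ↥b ≃ ↥(innerBonds n y ∖ treeBonds n y)` identify the block's bonds with the off-tree inner bonds of the box
`box n y ⊂ ℤ^d` (sides `n_i ≤ 100M`, `1 ≤ M`), and extend a chart vector `v : ↥b → E_N` by zero to a 𝔤-valued bond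
configuration (`bd ↦ v (e⁻¹ bd)` off the tree, `0` on the tree and outside).  If the quadratic member obeys print's (1.7)
row against that configuration's `Σ_{p∈Λ}|∂·|²` and `Σ_{b′}‖v b′‖²` for every `v`, and the smallness line holds, then
`∀ v, Ineq19 (Qf v) (Σ_{b′} ‖v b′‖²) γ₀ d M`. [cite: Balaban1989LargeFieldII, (1.7)–(1.9) p.358] [folklore] -/
theorem ineq19_blockChartSU_of_ineq17_box (b : Finset (PBond P j)) (M : ℕ) (hd : 1 ≤ d)
    (hnM : ∀ i, n i ≤ 100 * M) (hM : 1 ≤ M) (y : Fin d → ℤ) (e : ↥b ≃ ↥(innerBonds n y \ treeBonds n y))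
    (Qf : BlockChartSU N b → ℝ) {γ₀ C Rk εk : ℝ} (hγ : 0 ≤ γ₀)
    (h17 : ∀ v : BlockChartSU N b, Ineq17 (Qf v)
      (∑ p ∈ innerPlaq n y, ∑ a : Fin (dimSU N),
        curl (fun bd => if h : bd ∈ innerBonds n y \ treeBonds n y then v (e.symm ⟨bd, h⟩) a else (0 : ℝ))
          p.1 p.2.1 p.2.2 ^ 2)
      (∑ i, ‖v i‖ ^ 2) γ₀ C M Rk εk)
    (hsmall : C * ((M : ℝ) ^ 6 * Rk * εk + Real.exp (-Rk)) ≤ γ₀ / (2 * d * (100 * (M : ℝ)) ^ (d + 1))) :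
    ∀ v : BlockChartSU N b, Ineq19 (Qf v) (∑ i, ‖v i‖ ^ 2) γ₀ d M := by
  intro v
  have hM' : (0 : ℝ) < (M : ℝ) := by exact_mod_cast hM
  have hnB : (0 : ℝ) ≤ ∑ i, ‖v i‖ ^ 2 := Finset.sum_nonneg fun i _ => sq_nonneg _
  -- the chart vector pulled back along the dictionary, as coordinates on the off-tree box frame
  set w : ↥(innerBonds n y \ treeBonds n y) × Fin (dimSU N) → ℝ := fun q => v (e.symm q.1) q.2 with hw
  -- the extension by zero of `w` is the configuration of the statement
  have hext : (fun (bd : (Fin d → ℤ) × Fin d) (a : Fin (dimSU N)) =>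
      if h : bd ∈ innerBonds n y \ treeBonds n y then v (e.symm ⟨bd, h⟩) a else (0 : ℝ)) =
      fun bd a => if h : bd ∈ innerBonds n y \ treeBonds n y then w (⟨bd, h⟩, a) else (0 : ℝ) := by
    funext bd a
    simp only [hw]
  -- it vanishes on the tree and its sum of squares over the box's bonds is `Σ_{b′} ‖v b′‖²` (file 8 §1 + p604008)
  have htree : ∀ bd ∈ treeBonds n y,
      (fun a : Fin (dimSU N) =>
        if h : bd ∈ innerBonds n y \ treeBonds n y then v (e.symm ⟨bd, h⟩) a else (0 : ℝ)) = 0 := by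
    intro bd hbd
    have h0 := extendOffSubfinset_eq_zero w bd hbd
    funext a
    have := congrFun h0 a
    simpa only [hw] using this
  have hsq : ∑ bd ∈ innerBonds n y, ∑ a : Fin (dimSU N),
      (if h : bd ∈ innerBonds n y \ treeBonds n y then v (e.symm ⟨bd, h⟩) a else (0 : ℝ)) ^ 2 = ∑ i, ‖v i‖ ^ 2 := by
    have h1 := sum_sq_extendOffSubfinset (treeBonds_subset_innerBonds (n := n) y) w
    have h2 : ∑ q, w q ^ 2 = ∑ i, ‖v i‖ ^ 2 := by
      rw [← sum_sq_flatten b v, Fintype.sum_prod_type, Fintype.sum_prod_type]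
      exact e.symm.sum_comp (fun i : ↥b => ∑ a : Fin (dimSU N), (v i a) ^ 2)
    rw [← h2, ← h1]
  have h18raw := ineq18_box_vec (D := dimSU N) M hM hnM y
    (fun (bd : (Fin d → ℤ) × Fin d) (a : Fin (dimSU N)) =>
      if h : bd ∈ innerBonds n y \ treeBonds n y then v (e.symm ⟨bd, h⟩) a else (0 : ℝ)) htree
  rw [hsq] at h18raw
  exact ineq19_of_17_18 hd hM' hγ hnB (h17 v) h18raw hsmall

end Coercivity

/-! ## §2  ★★ Convexity of the (1.2)-shaped exponent on `BlockChartSU N b` from the (1.7) row, box carrier -/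

section Convexity

variable {n : Fin d → ℕ}

/-- ★★ **CONVEXITY ON `BlockChartSU N b` FROM THE (1.7) ROW, BOX CARRIER** = file 5's ★★′-loc
`convexOn_blockChartSU_expansion_of_analyticSupBound_local` with `h19` DISCHARGED by §1 (box bond dictionary `e`, (1.7)
∀ v, smallness line), the analyticity letter and the clause `4·d·(100M)^{d+1}·S ≤ γ₀·r²` as there.
[cite: Balaban1989LargeFieldII, (1.7)–(1.9) p.358] [textbook] -/
theorem convexOn_blockChartSU_expansion_of_ineq17_analyticSupBound_box (b : Finset (PBond P j)) (M : ℕ)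
    (hd : 1 ≤ d) (hnM : ∀ i, n i ≤ 100 * M) (hM : 1 ≤ M) (y : Fin d → ℤ)
    (e : ↥b ≃ ↥(innerBonds n y \ treeBonds n y))
    {K : Set (BlockChartSU N b)} (hK : Convex ℝ K) (φ Qf lin Vt : BlockChartSU N b → ℝ) (c : ℝ)
    (hexp : ∀ v ∈ K, φ v = c + 1 / 2 * Qf v + lin v + Vt v)
    (A : Matrix (↥b × Fin (dimSU N)) (↥b × Fin (dimSU N)) ℝ)
    (hQf : ∀ v, Qf v = (fun q : ↥b × Fin (dimSU N) => v q.1 q.2) ⬝ᵥ (A *ᵥ fun q => v q.1 q.2))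
    {γ₀ C Rk εk : ℝ} (hγ : 0 ≤ γ₀)
    (h17 : ∀ v : BlockChartSU N b, Ineq17 (Qf v)
      (∑ p ∈ innerPlaq n y, ∑ a : Fin (dimSU N),
        curl (fun bd => if h : bd ∈ innerBonds n y \ treeBonds n y then v (e.symm ⟨bd, h⟩) a else (0 : ℝ))
          p.1 p.2.1 p.2.2 ^ 2)
      (∑ i, ‖v i‖ ^ 2) γ₀ C M Rk εk)
    (hsmall : C * ((M : ℝ) ^ 6 * Rk * εk + Real.exp (-Rk)) ≤ γ₀ / (2 * d * (100 * (M : ℝ)) ^ (d + 1)))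
    (ℓ : BlockChartSU N b →ₗ[ℝ] ℝ) (hlin : ∀ v, lin v = ℓ v)
    (Φ : (↥b × Fin (dimSU N) → ℂ) → ℂ) {r S : ℝ} (hr : 0 < r)
    (hVt : ∀ x ∈ K, Vt x = (Φ fun q => ((x q.1 q.2 : ℝ) : ℂ)).re)
    (hΦd : ∀ x ∈ K, DifferentiableOn ℂ Φ (ball (fun q => ((x q.1 q.2 : ℝ) : ℂ)) r))
    (hΦS : ∀ x ∈ K, ∀ u ∈ ball (fun q : ↥b × Fin (dimSU N) => ((x q.1 q.2 : ℝ) : ℂ)) r, ‖Φ u‖ ≤ S)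
    (hclause : 4 * d * (100 * (M : ℝ)) ^ (d + 1) * S ≤ γ₀ * r ^ 2) :
    ConvexOn ℝ K φ :=
  convexOn_blockChartSU_expansion_of_analyticSupBound_local b hK φ Qf lin Vt c hexp A hQf hd (by exact_mod_cast hM)
    (ineq19_blockChartSU_of_ineq17_box b M hd hnM hM y e Qf hγ h17 hsmall) ℓ hlin Φ hr hVt hΦd hΦS hclause

end Convexity

/-! ## §3  The bond dictionary exists for every non-wrapping BOX of the torus `T^{(j)}` -/

section Dictionary

/-- **REDUCTION `mod` THE PERIOD IS INJECTIVE ON THE BONDS STARTING IN A BOX WITH SIDES `n_i ≤ period`**: two bonds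
`(z, μ)`, `(z′, μ′)` with `z, z′ ∈ box n y` and the same image `⟨z mod m, μ⟩ = ⟨z′ mod m, μ′⟩` in `PBond P j`
(`m = P.sitesPerDir j ≥ n_i`) coincide — coordinatewise `z_i ≡ z′_i (mod m)` with `|z_i − z′_i| < n_i ≤ m`. [folklore] -/
theorem toPBond_injOn_box {n : Fin P.d → ℕ} (hn : ∀ i, n i ≤ P.sitesPerDir j) (y : Fin P.d → ℤ) :
    Set.InjOn (fun bd : (Fin P.d → ℤ) × Fin P.d =>
        (⟨fun i => ((bd.1 i : ℤ) : ZMod (P.sitesPerDir j)), bd.2⟩ : PBond P j))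
      {bd | bd.1 ∈ box n y} := by
  intro bd hbd bd' hbd' h
  simp only [Set.mem_setOf_eq] at hbd hbd'
  have hdir : bd.2 = bd'.2 := congrArg PBond.dir h
  have hsrc : ∀ i, ((bd.1 i : ℤ) : ZMod (P.sitesPerDir j)) = ((bd'.1 i : ℤ) : ZMod (P.sitesPerDir j)) :=
    fun i => congrFun (congrArg PBond.src h) i
  have hz : bd.1 = bd'.1 := by
    funext i
    have hmod := (ZMod.intCast_eq_intCast_iff_dvd_sub _ _ _).1 (hsrc i).symm
    have h1 := mem_box.1 hbd i
    have h2 := mem_box.1 hbd' i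
    have hm : (n i : ℤ) ≤ (P.sitesPerDir j : ℤ) := by exact_mod_cast hn i
    have habs : (bd.1 i - bd'.1 i).natAbs < (P.sitesPerDir j : ℤ).natAbs := by
      rw [Int.natAbs_natCast]
      have : (bd.1 i - bd'.1 i).natAbs < n i := by omega
      omega
    have := Int.eq_zero_of_dvd_of_natAbs_lt_natAbs hmod habs
    omega
  exact Prod.ext hz hdir

/-- ★ **THE BOX BOND DICTIONARY EXISTS** (A6 for §1's datum): for every corner `y` and sides `n` with
`∀ i, n i ≤ P.sitesPerDir j` (the box does not wrap around `T^{(j)}`), the off-tree inner bonds of `box n y`, read on the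
torus by reducing coordinates `mod` the period, form a `b : Finset (PBond P j)` in bijection `e` with them, and `e⁻¹` IS
that reduction (no junk bijection). [folklore] -/
theorem exists_offTreeBox_equiv {n : Fin P.d → ℕ} (hn : ∀ i, n i ≤ P.sitesPerDir j) (y : Fin P.d → ℤ) :
    ∃ (b : Finset (PBond P j)) (e : ↥b ≃ ↥(innerBonds n y \ treeBonds n y)),
      ∀ s : ↥(innerBonds n y \ treeBonds n y),
        ((e.symm s : ↥b) : PBond P j) =
          ⟨fun i => (((s : (Fin P.d → ℤ) × Fin P.d).1 i : ℤ) : ZMod (P.sitesPerDir j)), (s : (Fin P.d → ℤ) × Fin P.d).2⟩ := by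
  classical
  set S : Finset ((Fin P.d → ℤ) × Fin P.d) := innerBonds n y \ treeBonds n y with hS
  set f : (Fin P.d → ℤ) × Fin P.d → PBond P j :=
    fun bd => ⟨fun i => ((bd.1 i : ℤ) : ZMod (P.sitesPerDir j)), bd.2⟩ with hf
  have hinj : Set.InjOn f (S : Set ((Fin P.d → ℤ) × Fin P.d)) := by
    refine (toPBond_injOn_box (P := P) (j := j) hn y).mono fun bd hbd => ?_
    have hbd' : bd ∈ innerBonds n y := (mem_sdiff.1 (Finset.mem_coe.1 hbd)).1
    exact (mem_innerBonds.1 hbd').1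
  have hbij : Set.BijOn f (S : Set ((Fin P.d → ℤ) × Fin P.d)) ((S.image f : Finset (PBond P j)) : Set (PBond P j)) := by
    rw [Finset.coe_image]
    exact hinj.bijOn_image
  refine ⟨S.image f, (hbij.equiv f).symm, fun s => ?_⟩
  rw [Equiv.symm_symm]
  rfl

end Dictionary

/-! ## §4  Knit: file 7's cube dictionary is the box dictionary at constant sides -/

section Knit

/-- **FILE 7's ★ FROM THE BOX ★** (`n = fun _ ↦ L`; the carriers agree by file 8 §0 ∕ `treeBonds_const`): for every
corner `y` and side `L ≤ P.sitesPerDir j` the CUBE dictionary of `N21ChartExponentCoercivitySUN.exists_offTreeBlock_equiv`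
exists — re-derived from §3. [folklore] -/
theorem exists_offTreeBlock_equiv_of_box {L : ℕ} (hL : L ≤ P.sitesPerDir j) (y : Fin P.d → ℤ) :
    ∃ (b : Finset (PBond P j))
      (e : ↥b ≃ ↥(B6TreeGaugePoincare.innerBonds L y \ B6BondElimination.treeBonds L y)),
      ∀ s : ↥(B6TreeGaugePoincare.innerBonds L y \ B6BondElimination.treeBonds L y),
        ((e.symm s : ↥b) : PBond P j) =
          ⟨fun i => (((s : (Fin P.d → ℤ) × Fin P.d).1 i : ℤ) : ZMod (P.sitesPerDir j)), (s : (Fin P.d → ℤ) × Fin P.d).2⟩ := by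
  rw [← innerBonds_const, ← treeBonds_const]
  exact exists_offTreeBox_equiv (fun _ => hL) y

end Knit

end Summit.QuantumFields.YangMills.Theorems.N21ChartExponentCoercivityBoxSUN

end
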